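import Mathlib

/-!
# `ChannelsResolveTameDevelopments` (stmt-FinalStateConjecture-10046, route PhotonSphereChannels) —
# negative-side lemmas II: energy on an inward-shrinking interval and on half-lines

Abstract energy method for a `C¹` density `e` and flux `F` on `ℝ² = ℝ_t × ℝ_x` obeying the local
conservation law `∂_t e = ∂_x F` (directional `fderiv`s) and the flux bound `|F| ≤ e` (the situation of
`φ_t² + φ_x² + Vφ²` and `2φ_tφ_x` for waves with `V ≥ 0`, `WaveSliceCalculus.lean`):

* `integral_shrinking_le` — **core lemma**: `∫_{b+t}^{K−t} e(t,·) ≤ ∫_{b+T}^{K−T} e(T,·)` for `T ≤ t`,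
  `b + 2t < K`.  Proof: Mathlib's divergence theorem on the rectangle `[T,t] × [0,1]`
  (`integral_divergence_prod_Icc_of_hasFDerivAt_of_le`) applied to the straightened fields
  `f = J·(e∘Φ)`, `g = −F∘Φ − (1−2θ)·(e∘Φ)` with `Φ(s,θ) = (s, b+s+J(s)θ)`, `J(s) = K−b−2s`, whose
  divergence vanishes identically; the two edge terms are `∫(e ∓ F) ≥ 0`.
* `lintegral_Ioi_le`, `lintegral_Iio_le` — the lower Lebesgue integrals of `ofReal ∘ e(s,·)` beyond an
  outgoing edge `b + s`, resp. before an ingoing edge `c − s`, are non-increasing in `s` (half-lines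
  exhausted by shrinking intervals, `setLIntegral_iUnion_of_directed`; no decay or finiteness needed).

Refuter seat `refuter-cdisprove-stmt-FinalStateConjecture-10046-0`, 2026-08-15.

## References

* C. Kenig, A. Lawrie, B. Liu, W. Schlag, Adv. Math. 285 (2015) 877–936, §1 (key `KenigEtAl2015`).
* T. Duyckaerts, C. Kenig, F. Merle, Camb. J. Math. 1 (2013) 75–144, §2 (exterior energy on
  `{|x| > R + |t|}`) (key `DuyckaertsKenigMerle2013`).
-/

noncomputable section

open Filter Set MeasureTheory intervalIntegral
open scoped Topology ENNReal

namespace Summit.FinalStateConjecture.FinalStateConjecture.Theorems.ChannelsResolveTameDevelopments.Negative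

/-! ### Two slice lemmas (private copies; the named versions live in `WaveSliceCalculus.lean`) -/

/-- The horizontal line `τ ↦ (τ, x)` has velocity `(1, 0)`. [folklore] -/
private theorem curve_t (x t : ℝ) : HasDerivAt (fun τ : ℝ ↦ ((τ, x) : ℝ × ℝ)) (1, 0) t :=
  (hasDerivAt_id t).prodMk (hasDerivAt_const t x)

/-- The vertical line `y ↦ (t, y)` has velocity `(0, 1)`. [folklore] -/
private theorem curve_x (t x : ℝ) : HasDerivAt (fun y : ℝ ↦ ((t, y) : ℝ × ℝ)) (0, 1) x :=
  (hasDerivAt_const x t).prodMk (hasDerivAt_id x)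

/-- Directional derivative `(1,0)` = `deriv` of the `t`-slice. [folklore] -/
private theorem fderiv_one_zero {G : ℝ × ℝ → ℝ} {t x : ℝ} (hG : DifferentiableAt ℝ G (t, x)) :
    fderiv ℝ G (t, x) (1, 0) = deriv (fun τ ↦ G (τ, x)) t :=
  ((hG.hasFDerivAt.comp_hasDerivAt t (curve_t x t)).deriv).symm

/-- Directional derivative `(0,1)` = `deriv` of the `x`-slice. [folklore] -/
private theorem fderiv_zero_one {G : ℝ × ℝ → ℝ} {t x : ℝ} (hG : DifferentiableAt ℝ G (t, x)) :
    fderiv ℝ G (t, x) (0, 1) = deriv (fun y ↦ G (t, y)) x :=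
  ((hG.hasFDerivAt.comp_hasDerivAt x (curve_x t x)).deriv).symm

/-! ### The trapezoid inequality from the divergence theorem on a rectangle -/

section Trapezoid

variable {e F : ℝ × ℝ → ℝ}

/-- **Core lemma.** If `e, F ∈ C¹(ℝ²)` satisfy the conservation law `∂_t e = ∂_x F` and the flux
bound `|F| ≤ e`, then the energy on the inward-shrinking interval `(b + s, K − s)` is
non-increasing: for `T ≤ t` with `b + 2t < K`,
`∫_{b+t}^{K−t} e(t,x) dx ≤ ∫_{b+T}^{K−T} e(T,x) dx`. [folklore] -/
theorem integral_shrinking_le (he : ContDiff ℝ 1 e) (hF : ContDiff ℝ 1 F)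
    (hcons : ∀ p, fderiv ℝ e p (1, 0) = fderiv ℝ F p (0, 1)) (hbound : ∀ p, |F p| ≤ e p)
    {b K T t : ℝ} (hTt : T ≤ t) (hK : b + 2 * t < K) :
    ∫ x in (b + t)..(K - t), e (t, x) ≤ ∫ x in (b + T)..(K - T), e (T, x) := by
  -- straightening map and the two fields on the rectangle `[T, t] × [0, 1]`
  set J : ℝ → ℝ := fun s ↦ K - b - 2 * s with hJ
  set Φ : ℝ × ℝ → ℝ × ℝ := fun q ↦ (q.1, b + q.1 + J q.1 * q.2) with hΦ
  set f : ℝ × ℝ → ℝ := fun q ↦ J q.1 * e (Φ q) with hf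
  set g : ℝ × ℝ → ℝ := fun q ↦ -F (Φ q) - (1 - 2 * q.2) * e (Φ q) with hg
  have hed : Differentiable ℝ e := he.differentiable one_ne_zero
  have hFd : Differentiable ℝ F := hF.differentiable one_ne_zero
  have hJd : Differentiable ℝ J := by fun_prop
  have hΦd : Differentiable ℝ Φ := by fun_prop
  have hfd : Differentiable ℝ f := by
    rw [hf]; exact (hJd.comp differentiable_fst).mul (hed.comp hΦd)
  have hgd : Differentiable ℝ g := by
    rw [hg]
    exact ((hFd.comp hΦd).neg).sub ((differentiable_const _ |>.sub
      ((differentiable_const _).mul differentiable_snd)).mul (hed.comp hΦd))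
  -- curves through `q = (s, θ)`
  have hγ : ∀ s θ : ℝ, HasDerivAt (fun σ ↦ Φ (σ, θ)) ((1 : ℝ), 1 - 2 * θ) s := by
    intro s θ
    have h1 : HasDerivAt (fun σ : ℝ ↦ b + σ + (K - b - 2 * σ) * θ) (1 - 2 * θ) s :=
      ((((hasDerivAt_id' s).const_add b).add
        ((((hasDerivAt_id' s).const_mul 2).const_sub (K - b)).mul_const θ))).congr_deriv (by ring)
    exact (hasDerivAt_id' s).prodMk h1
  have hδ : ∀ s θ : ℝ, HasDerivAt (fun ϑ ↦ Φ (s, ϑ)) ((0 : ℝ), J s) θ := by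
    intro s θ
    have h1 : HasDerivAt (fun ϑ : ℝ ↦ b + s + J s * ϑ) (J s) θ :=
      (((hasDerivAt_id' θ).const_mul (J s)).const_add (b + s)).congr_deriv (by ring)
    exact (hasDerivAt_const θ s).prodMk h1
  -- the divergence vanishes identically
  have hdiv : ∀ q : ℝ × ℝ, fderiv ℝ f q (1, 0) + fderiv ℝ g q (0, 1) = 0 := by
    intro q
    obtain ⟨s, θ⟩ := q
    have hlin1 : ((1 : ℝ), 1 - 2 * θ) = ((1 : ℝ), (0 : ℝ)) + (1 - 2 * θ) • ((0 : ℝ), (1 : ℝ)) := by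
      ext <;> simp
    have hlin2 : ((0 : ℝ), J s) = (J s) • ((0 : ℝ), (1 : ℝ)) := by ext <;> simp
    -- ∂_s f
    have hfs : HasDerivAt (fun σ ↦ f (σ, θ))
        (-2 * e (Φ (s, θ)) + J s * (fderiv ℝ e (Φ (s, θ)) (1, 0)
          + (1 - 2 * θ) * fderiv ℝ e (Φ (s, θ)) (0, 1))) s := by
      have hJ' : HasDerivAt J (-2) s :=
        (((hasDerivAt_id' s).const_mul 2).const_sub (K - b)).congr_deriv (by ring)
      have heγ : HasDerivAt (fun σ ↦ e (Φ (σ, θ))) (fderiv ℝ e (Φ (s, θ)) (1, 1 - 2 * θ)) s :=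
        (hed (Φ (s, θ))).hasFDerivAt.comp_hasDerivAt s (hγ s θ)
      refine (hJ'.fun_mul heγ).congr_deriv ?_
      rw [hlin1, map_add, map_smul, smul_eq_mul]
    -- ∂_θ g
    have hgθ : HasDerivAt (fun ϑ ↦ g (s, ϑ))
        (-(J s * fderiv ℝ F (Φ (s, θ)) (0, 1))
          - (-2 * e (Φ (s, θ)) + (1 - 2 * θ) * (J s * fderiv ℝ e (Φ (s, θ)) (0, 1)))) θ := by
      have hFδ : HasDerivAt (fun ϑ ↦ F (Φ (s, ϑ))) (fderiv ℝ F (Φ (s, θ)) (0, J s)) θ :=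
        (hFd (Φ (s, θ))).hasFDerivAt.comp_hasDerivAt θ (hδ s θ)
      have heδ : HasDerivAt (fun ϑ ↦ e (Φ (s, ϑ))) (fderiv ℝ e (Φ (s, θ)) (0, J s)) θ :=
        (hed (Φ (s, θ))).hasFDerivAt.comp_hasDerivAt θ (hδ s θ)
      have hl : HasDerivAt (fun ϑ : ℝ ↦ 1 - 2 * ϑ) (-2) θ :=
        (((hasDerivAt_id' θ).const_mul 2).const_sub 1).congr_deriv (by ring)
      refine ((hFδ.fun_neg).fun_sub (hl.fun_mul heδ)).congr_deriv ?_
      rw [hlin2, map_smul, map_smul, smul_eq_mul, smul_eq_mul]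
    rw [fderiv_one_zero (hfd _), fderiv_zero_one (hgd _), hfs.deriv, hgθ.deriv,
      hcons (Φ (s, θ))]
    ring
  -- Green on the rectangle `[T, t] × [0, 1]`
  have hle : ((T, 0) : ℝ × ℝ) ≤ (t, 1) := ⟨hTt, zero_le_one⟩
  have green := MeasureTheory.integral_divergence_prod_Icc_of_hasFDerivAt_of_le f g
    (fderiv ℝ f) (fderiv ℝ g) (T, 0) (t, 1) hle
    (hfd.continuous.continuousOn) (hgd.continuous.continuousOn)
    (fun q _ ↦ (hfd q).hasFDerivAt) (fun q _ ↦ (hgd q).hasFDerivAt)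
    (by
      have h0 : (fun q : ℝ × ℝ ↦ fderiv ℝ f q (1, 0) + fderiv ℝ g q (0, 1)) = fun _ ↦ 0 :=
        funext hdiv
      rw [h0]; exact integrableOn_zero)
  have h0' : (∫ q in Icc ((T, 0) : ℝ × ℝ) (t, 1), fderiv ℝ f q (1, 0) + fderiv ℝ g q (0, 1)) = 0 := by
    simp [hdiv]
  rw [h0'] at green
  simp only at green
  -- signs of the two `g`-integrals
  have hg1 : 0 ≤ ∫ s in T..t, g (s, 1) := by
    apply intervalIntegral.integral_nonneg hTt
    intro s _
    simp only [hg]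
    have := hbound (Φ (s, 1))
    rw [abs_le] at this
    nlinarith
  have hg0 : ∫ s in T..t, g (s, 0) ≤ 0 := by
    have : 0 ≤ ∫ s in T..t, -g (s, 0) := by
      apply intervalIntegral.integral_nonneg hTt
      intro s _
      simp only [hg]
      have := hbound (Φ (s, 0))
      rw [abs_le] at this
      nlinarith
    simpa [intervalIntegral.integral_neg] using this
  -- the `f`-integrals are the energies on the moving interval
  have hfint : ∀ s : ℝ, b + 2 * s < K →
      ∫ θ in (0 : ℝ)..1, f (s, θ) = ∫ x in (b + s)..(K - s), e (s, x) := by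
    intro s hs
    have hJ0 : J s ≠ 0 := by simp only [hJ]; linarith
    simp only [hf, hΦ]
    rw [intervalIntegral.integral_const_mul]
    have := intervalIntegral.integral_comp_mul_add (a := 0) (b := 1) (fun x ↦ e (s, x)) hJ0 (b + s)
    simp only [mul_zero, zero_add, mul_one] at this
    have hmul : ∀ θ : ℝ, b + s + J s * θ = J s * θ + (b + s) := fun θ ↦ by ring
    simp_rw [hmul, this, smul_eq_mul, ← mul_assoc, mul_inv_cancel₀ hJ0, one_mul]
    congr 1
    simp only [hJ]; ring
  have hT' : b + 2 * T < K := by linarith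
  rw [hfint t hK, hfint T hT'] at green
  linarith

end Trapezoid

/-! ### From the moving interval to half-lines: lower Lebesgue integrals -/

section HalfLines

variable {e F : ℝ × ℝ → ℝ}

/-- A flux-dominating density is nonnegative. [folklore] -/
theorem nonneg_of_flux_bound (hbound : ∀ p, |F p| ≤ e p) (p : ℝ × ℝ) : 0 ≤ e p :=
  (abs_nonneg _).trans (hbound p)

/-- On a bounded interval the lower integral of `ofReal ∘ e(s, ·)` is `ofReal` of the interval
integral. [folklore] -/
theorem lintegral_Ioo_eq_ofReal (he : Continuous e) (hnn : ∀ p, 0 ≤ e p) {a c : ℝ} (hac : a ≤ c)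
    (s : ℝ) : ∫⁻ x in Ioo a c, ENNReal.ofReal (e (s, x)) = ENNReal.ofReal (∫ x in a..c, e (s, x)) := by
  have hcont : Continuous fun x ↦ e (s, x) := he.comp (continuous_const.prodMk continuous_id)
  have hint : IntegrableOn (fun x ↦ e (s, x)) (Ioo a c) :=
    (hcont.integrableOn_Icc).mono_set Ioo_subset_Icc_self
  rw [intervalIntegral.integral_of_le hac, integral_Ioc_eq_integral_Ioo,
    ofReal_integral_eq_lintegral_ofReal hint (Filter.Eventually.of_forall fun x ↦ hnn _)]

/-- The core inequality in `ℝ≥0∞` form (lower integrals of `ofReal ∘ e`). [folklore] -/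
theorem lintegral_Ioo_shrinking_le (he : ContDiff ℝ 1 e) (hF : ContDiff ℝ 1 F)
    (hcons : ∀ p, fderiv ℝ e p (1, 0) = fderiv ℝ F p (0, 1)) (hbound : ∀ p, |F p| ≤ e p)
    {b K T t : ℝ} (hTt : T ≤ t) (hK : b + 2 * t < K) :
    ∫⁻ x in Ioo (b + t) (K - t), ENNReal.ofReal (e (t, x)) ≤
      ∫⁻ x in Ioo (b + T) (K - T), ENNReal.ofReal (e (T, x)) := by
  have hnn := nonneg_of_flux_bound hbound
  rw [lintegral_Ioo_eq_ofReal he.continuous hnn (by linarith) t,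
    lintegral_Ioo_eq_ofReal he.continuous hnn (by linarith) T]
  exact ENNReal.ofReal_le_ofReal (integral_shrinking_le he hF hcons hbound hTt hK)

/-- **Right half-line**: the energy beyond the outgoing edge `b + s` is non-increasing. [folklore] -/
theorem lintegral_Ioi_le (he : ContDiff ℝ 1 e) (hF : ContDiff ℝ 1 F)
    (hcons : ∀ p, fderiv ℝ e p (1, 0) = fderiv ℝ F p (0, 1)) (hbound : ∀ p, |F p| ≤ e p)
    {T t : ℝ} (hTt : T ≤ t) (b : ℝ) :
    ∫⁻ x in Ioi (b + t), ENNReal.ofReal (e (t, x)) ≤ ∫⁻ x in Ioi (b + T), ENNReal.ofReal (e (T, x)) := by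
  -- exhaust `Ioi (b + t)` by the intervals `Ioo (b + t) (K n - t)`, `K n = b + 2t + 1 + n`
  set K : ℕ → ℝ := fun n ↦ b + 2 * t + 1 + n with hK
  have hU : Ioi (b + t) = ⋃ n : ℕ, Ioo (b + t) (K n - t) := by
    ext x
    simp only [mem_Ioi, mem_iUnion, mem_Ioo]
    constructor
    · intro hx
      obtain ⟨n, hn⟩ := exists_nat_gt (x - (b + t + 1))
      exact ⟨n, hx, by simp only [hK]; linarith⟩
    · rintro ⟨n, hx, -⟩; exact hx
  have hdir : Directed (· ⊆ ·) fun n : ℕ ↦ Ioo (b + t) (K n - t) := by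
    refine Monotone.directed_le fun m n hmn ↦ Ioo_subset_Ioo le_rfl ?_
    simp only [hK]
    have : (m : ℝ) ≤ n := by exact_mod_cast hmn
    linarith
  rw [hU, setLIntegral_iUnion_of_directed _ hdir]
  refine iSup_le fun n ↦ ?_
  have hKn : b + 2 * t < K n := by
    simp only [hK]; have : (0 : ℝ) ≤ n := n.cast_nonneg; linarith
  calc ∫⁻ x in Ioo (b + t) (K n - t), ENNReal.ofReal (e (t, x))
      ≤ ∫⁻ x in Ioo (b + T) (K n - T), ENNReal.ofReal (e (T, x)) :=
        lintegral_Ioo_shrinking_le he hF hcons hbound hTt hKn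
    _ ≤ ∫⁻ x in Ioi (b + T), ENNReal.ofReal (e (T, x)) :=
        lintegral_mono_set fun x hx ↦ hx.1

/-- **Left half-line**: the energy before the ingoing edge `c - s` is non-increasing. [folklore] -/
theorem lintegral_Iio_le (he : ContDiff ℝ 1 e) (hF : ContDiff ℝ 1 F)
    (hcons : ∀ p, fderiv ℝ e p (1, 0) = fderiv ℝ F p (0, 1)) (hbound : ∀ p, |F p| ≤ e p)
    {T t : ℝ} (hTt : T ≤ t) (c : ℝ) :
    ∫⁻ x in Iio (c - t), ENNReal.ofReal (e (t, x)) ≤ ∫⁻ x in Iio (c - T), ENNReal.ofReal (e (T, x)) := by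
  -- exhaust `Iio (c - t)` by `Ioo (B n + t) (c - t)`, `B n = c - 2t - 1 - n`
  set B : ℕ → ℝ := fun n ↦ c - 2 * t - 1 - n with hB
  have hU : Iio (c - t) = ⋃ n : ℕ, Ioo (B n + t) (c - t) := by
    ext x
    simp only [mem_Iio, mem_iUnion, mem_Ioo]
    constructor
    · intro hx
      obtain ⟨n, hn⟩ := exists_nat_gt ((c - t - 1) - x)
      exact ⟨n, by simp only [hB]; linarith, hx⟩
    · rintro ⟨n, -, hx⟩; exact hx
  have hdir : Directed (· ⊆ ·) fun n : ℕ ↦ Ioo (B n + t) (c - t) := by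
    refine Monotone.directed_le fun m n hmn ↦ Ioo_subset_Ioo ?_ le_rfl
    simp only [hB]
    have : (m : ℝ) ≤ n := by exact_mod_cast hmn
    linarith
  rw [hU, setLIntegral_iUnion_of_directed _ hdir]
  refine iSup_le fun n ↦ ?_
  have hKn : B n + 2 * t < c := by
    simp only [hB]; have : (0 : ℝ) ≤ n := n.cast_nonneg; linarith
  calc ∫⁻ x in Ioo (B n + t) (c - t), ENNReal.ofReal (e (t, x))
      ≤ ∫⁻ x in Ioo (B n + T) (c - T), ENNReal.ofReal (e (T, x)) :=
        lintegral_Ioo_shrinking_le he hF hcons hbound hTt hKn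
    _ ≤ ∫⁻ x in Iio (c - T), ENNReal.ofReal (e (T, x)) :=
        lintegral_mono_set fun x hx ↦ hx.2

end HalfLines


end Summit.FinalStateConjecture.FinalStateConjecture.Theorems.ChannelsResolveTameDevelopments.Negative

end
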